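import Literature.NumberTheory.EllipticCurves.BinaryQuarticOrbitWeights
import Literature.NumberTheory.EllipticCurves.BinaryQuarticAdditive
import Literature.MeasureTheory.Group.PadicIntHaarScaling
import HarnessLib

/-!
# The twisted action of `GL₂(ℤ_p)` on `V_{ℤ_p}` and its invariance of the `p`-adic measure
# (Bhargava–Shankar's `PGL₂(ℤ_p)` acting on `V_{ℤ_p}`)

Topic `Literature/NumberTheory/EllipticCurves`; continues `BinaryQuarticOrbitWeights.lean` (the
twisted action `g · f = (det g)⁻² f((x,y)g)` of `GL₂(K)` over a *field*, scoped instance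
`instMulActionGL`), `BinaryQuarticAdditive.lean` (the module `V_R`, the Haar measure on
`V_{ℤ_p}`) and `Literature/MeasureTheory/Group/PadicIntHaarScaling.lean` (continuous additive
automorphisms of `ℤ_pⁿ` preserve its measure). One scoped instance, definitions, theorems; no
named facts.

Bhargava–Shankar (Ann. of Math. 181 (2015), §3.2–3.3 of the published version; Prop. 5.12 of
`arXiv:1006.1002v2`: "`B_p^F := ⋃ PGL₂(ℤ_p) · f`", "the `p`-adic density `μ_p(S^F)`") let
`PGL₂(ℤ_p)` act on `V_{ℤ_p}` through the twisted action, under which `I`, `J`, `Δ` and the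
measure `μ_p` are invariant. Over a ring in which `det g` is a unit the twist `(det g)⁻²` makes
sense integrally; this file provides:

* `BinaryQuartic.IntegralAction.instMulActionGLInt` — **the twisted action of `GL₂(ℤ_p)` on
  `V_{ℤ_p}`**, `g • f = ((det g)⁻¹)² · f((x,y)g)` (scoped in `BinaryQuartic.IntegralAction`;
  registered for `ℤ_p` only, so as not to overlap with the field instance `instMulActionGL`, with
  which it agrees after `map`: `map_glInt_smul`, `map_glInt_smul'`), its effect on invariants
  (`I_glInt_smul`, `J_glInt_smul`, `disc_glInt_smul`), triviality of scalars (`scalarGL_smul`),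
  additivity (`glInt_smul_add`, `glInt_smul_smul`);
* `BinaryQuartic.smulAddEquiv g : V_R ≃+ V_R` and its continuity;
* **invariance of the measure**: `padicInt_volume_image_glInt_smul` — `μ_p(g • S) = μ_p(S)` for
  `g ∈ GL₂(ℤ_p)` and every `S ⊆ V_{ℤ_p}`, and `measurePreserving_glInt_smul`;
* compatibility with the orbit language of the tree: for `f ∈ V_{ℤ_p}` the image in `V_{ℚ_p}` of
  the `GL₂(ℤ_p)`-orbit of `f` is the `ℚ_pˣ·GL₂(ℤ_p)`-orbit of `f ⊗ ℚ_p`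
  (`image_orbit_eq_orbit_integralUpToScalars`).

## References

* M. Bhargava, A. Shankar, Ann. of Math. (2) 181 (2015) 191–242, §3.2–3.3 of the published
  version = Prop. 5.12 of arXiv:1006.1002v2 (the action of `PGL₂(ℤ_p)` on `V_{ℤ_p}`; `μ_p`).
  [cite: BhargavaShankarAnnals2015, Prop. 5.12 (PGL₂(ℤ_p) acting on V_{ℤ_p}; arXiv:1006.1002v2 numbering)]
-/

noncomputable section

open scoped Classical
open Matrix MulAction MeasureTheory Set

namespace Literature.NumberTheory.EllipticCurves

namespace BinaryQuartic

/-! ## The twisted action of `GL₂(ℤ_p)` -/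

section Ring

variable {p : ℕ} [Fact p.Prime]

/- Notation: throughout, `R = ℤ_[p]`; the action is registered for `GL₂(ℤ_p)` only (over a field
the tree's `instMulActionGL` is the twisted action, and registering a second instance for all
commutative rings would make the two overlap). -/
local notation "R" => ℤ_[p]

/-- The twisted action `g · f = ((det g)⁻¹)² · f((x,y)g)` of `GL₂(R)` on `V_R` over a commutative
ring (the inverse determinant is the unit `(det g)⁻¹ ∈ Rˣ`). [cite: BhargavaShankarAnnals2015, §3.2 (published numbering)] -/
def glIntSMul (g : GL (Fin 2) R) (f : BinaryQuartic R) : BinaryQuartic R :=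
  (((Matrix.GeneralLinearGroup.det g)⁻¹ : Rˣ) : R) ^ 2 • f.subst (g : Matrix (Fin 2) (Fin 2) R)

/-- `glIntSMul 1 = id`. [folklore] -/
theorem glIntSMul_one (f : BinaryQuartic R) : glIntSMul 1 f = f := by
  simp [glIntSMul]

/-- `glIntSMul (g h) = glIntSMul g ∘ glIntSMul h`. [folklore] -/
theorem glIntSMul_mul (g h : GL (Fin 2) R) (f : BinaryQuartic R) :
    glIntSMul (g * h) f = glIntSMul g (glIntSMul h f) := by
  simp only [glIntSMul, map_mul, mul_inv, Units.val_mul, subst_mul, smul_subst, smul_smul]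
  congr 1
  ring

namespace IntegralAction

/-- **The twisted action of `GL₂(R)` on `V_R`** as a `MulAction` (scoped in
`BinaryQuartic.IntegralAction`). [cite: BhargavaShankarAnnals2015, §3.2 (published numbering)] -/
scoped instance instMulActionGLInt : MulAction (GL (Fin 2) R) (BinaryQuartic R) where
  smul := glIntSMul
  one_smul := glIntSMul_one
  mul_smul := glIntSMul_mul

end IntegralAction

open scoped IntegralAction

/-- Unfolding the action. [folklore] -/
theorem glInt_smul_def (g : GL (Fin 2) R) (f : BinaryQuartic R) :
    g • f = (((Matrix.GeneralLinearGroup.det g)⁻¹ : Rˣ) : R) ^ 2 • f.subst (g : Matrix (Fin 2) (Fin 2) R) := rfl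

/-- The twisting unit times the determinant is `1`. [folklore] -/
theorem det_mul_detInv (g : GL (Fin 2) R) :
    (g : Matrix (Fin 2) (Fin 2) R).det * (((Matrix.GeneralLinearGroup.det g)⁻¹ : Rˣ) : R) = 1 := by
  rw [← Matrix.GeneralLinearGroup.val_det_apply, Units.mul_inv]

/-- **`I` is invariant**: `I(g • f) = I(f)`. [cite: BhargavaShankarAnnals2015, §3.2 (I, J invariant under PGL₂; published numbering)] -/
theorem I_glInt_smul (g : GL (Fin 2) R) (f : BinaryQuartic R) : (g • f).I = f.I := by
  rw [glInt_smul_def, I_smul, I_subst]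
  have h := det_mul_detInv g
  calc _ = ((g : Matrix (Fin 2) (Fin 2) R).det * (((Matrix.GeneralLinearGroup.det g)⁻¹ : Rˣ) : R)) ^ 4 * f.I := by ring
    _ = f.I := by rw [h, one_pow, one_mul]

/-- **`J` is invariant**: `J(g • f) = J(f)`. [cite: BhargavaShankarAnnals2015, §3.2 (published numbering)] -/
theorem J_glInt_smul (g : GL (Fin 2) R) (f : BinaryQuartic R) : (g • f).J = f.J := by
  rw [glInt_smul_def, J_smul, J_subst]
  have h := det_mul_detInv g
  calc _ = ((g : Matrix (Fin 2) (Fin 2) R).det * (((Matrix.GeneralLinearGroup.det g)⁻¹ : Rˣ) : R)) ^ 6 * f.J := by ring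
    _ = f.J := by rw [h, one_pow, one_mul]

/-- **`Δ` is invariant.** [folklore] -/
theorem disc_glInt_smul (g : GL (Fin 2) R) (f : BinaryQuartic R) :
    (g • f).disc = f.disc := by
  have h27 : (27 : R) ≠ 0 := by norm_num
  apply mul_left_cancel₀ h27
  rw [twentySeven_mul_disc, twentySeven_mul_disc, I_glInt_smul, J_glInt_smul]

/-- The action is additive in the form. [folklore] -/
theorem glInt_smul_add (g : GL (Fin 2) R) (f f' : BinaryQuartic R) : g • (f + f') = g • f + g • f' := by
  rw [glInt_smul_def, glInt_smul_def, glInt_smul_def, subst_add, smul_add]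

/-- The action commutes with scalars of `R`. [folklore] -/
theorem glInt_smul_smul (g : GL (Fin 2) R) (t : R) (f : BinaryQuartic R) : g • (t • f) = t • (g • f) := by
  rw [glInt_smul_def, glInt_smul_def, smul_subst, smul_comm]

/-- The action of `g` as an additive automorphism of `V_R`. [folklore] -/
def smulAddEquiv (g : GL (Fin 2) R) : BinaryQuartic R ≃+ BinaryQuartic R where
  toFun f := g • f
  invFun f := g⁻¹ • f
  left_inv f := by simp [← mul_smul]
  right_inv f := by simp [← mul_smul]
  map_add' := glInt_smul_add g

/-- `smulAddEquiv g f = g • f` (definitional). [folklore] -/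
@[simp] theorem smulAddEquiv_apply (g : GL (Fin 2) R) (f : BinaryQuartic R) : smulAddEquiv g f = g • f := rfl

/-- **Scalar matrices act trivially**: for `c ∈ Rˣ`, `(c · 1) • f = f` (degree `4` against
`det² = c⁴`). [cite: BhargavaShankarAnnals2015, §3.2 (the action factors through PGL₂; published numbering)] -/
theorem scalarGL_smul (c : Rˣ) (f : BinaryQuartic R) :
    (Units.map (Matrix.scalar (Fin 2)).toMonoidHom c : GL (Fin 2) R) • f = f := by
  rw [glInt_smul_def]
  have hmat : ((Units.map (Matrix.scalar (Fin 2)).toMonoidHom c : GL (Fin 2) R) : Matrix (Fin 2) (Fin 2) R) =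
      (c : R) • (1 : Matrix (Fin 2) (Fin 2) R) := by
    simp [Matrix.smul_one_eq_diagonal]
  have hdet : (((Matrix.GeneralLinearGroup.det (Units.map (Matrix.scalar (Fin 2)).toMonoidHom c : GL (Fin 2) R))⁻¹ : Rˣ) : R)
      = ((c⁻¹ : Rˣ) : R) ^ 2 := by
    have h1 : Matrix.GeneralLinearGroup.det (Units.map (Matrix.scalar (Fin 2)).toMonoidHom c : GL (Fin 2) R) = c ^ 2 := by
      ext
      rw [Matrix.GeneralLinearGroup.val_det_apply, hmat, Matrix.det_smul, Matrix.det_one, mul_one,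
        Fintype.card_fin, Units.val_pow_eq_pow_val]
    rw [h1, ← inv_pow, Units.val_pow_eq_pow_val]
  rw [hdet, hmat]
  have hsub : f.subst ((c : R) • (1 : Matrix (Fin 2) (Fin 2) R)) = ((c : R) ^ 4) • f := by
    ext <;> simp [subst, Matrix.smul_apply] <;> ring
  rw [hsub, smul_smul]
  have : (((c⁻¹ : Rˣ) : R) ^ 2) ^ 2 * (c : R) ^ 4 = 1 := by
    rw [← pow_mul, show 2 * 2 = 4 by norm_num, ← mul_pow, Units.inv_mul, one_pow]
  rw [this, one_smul]

/-- **Compatibility with `V_{ℚ_p}`**: `(g • f) ⊗ ℚ_p = (g ⊗ ℚ_p) · (f ⊗ ℚ_p)`, the right-hand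
side being the twisted action `twist` of `GL₂(ℚ_p)` on `V_{ℚ_p}` (the tree's `instMulActionGL`).
[folklore] -/
theorem map_glInt_smul (g : GL (Fin 2) R) (f : BinaryQuartic R) :
    (g • f).map PadicInt.Coe.ringHom =
      twist ((g : Matrix (Fin 2) (Fin 2) R).map PadicInt.Coe.ringHom) (f.map PadicInt.Coe.ringHom) := by
  rw [glInt_smul_def, twist, ← map_subst]
  set φ := PadicInt.Coe.ringHom (p := p)
  have hdet : ((g : Matrix (Fin 2) (Fin 2) R).map φ).det = φ (g : Matrix (Fin 2) (Fin 2) R).det := by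
    rw [← RingHom.mapMatrix_apply, ← RingHom.map_det]
  have hu : φ (g : Matrix (Fin 2) (Fin 2) R).det * φ (((Matrix.GeneralLinearGroup.det g)⁻¹ : Rˣ) : R) = 1 := by
    rw [← map_mul, det_mul_detInv, map_one]
  have hinv : (((g : Matrix (Fin 2) (Fin 2) R).map φ).det ^ 2)⁻¹ = (φ (((Matrix.GeneralLinearGroup.det g)⁻¹ : Rˣ) : R)) ^ 2 := by
    rw [hdet, ← inv_pow, ← eq_inv_of_mul_eq_one_right hu]
  rw [hinv]
  ext <;> simp [BinaryQuartic.map]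

/-- The same with the `GL₂(ℚ_p)`-action of the tree (`instMulActionGL`, `g • F = twist ↑g F`).
[folklore] -/
theorem map_glInt_smul' (g : GL (Fin 2) R) (f : BinaryQuartic R) :
    (g • f).map PadicInt.Coe.ringHom =
      (Matrix.GeneralLinearGroup.map PadicInt.Coe.ringHom g : GL (Fin 2) ℚ_[p]) • (f.map PadicInt.Coe.ringHom) := by
  rw [map_glInt_smul, gl_smul_def]
  rfl

end Ring

/-! ## `GL₂(ℤ_p)` on `V_{ℤ_p}`: continuity and invariance of `μ_p` -/

section Padic

open scoped IntegralAction

variable {p : ℕ} [Fact p.Prime]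

/-- Substitution by a fixed matrix is continuous on `V_{ℤ_p}` (polynomial in the coefficients).
[folklore] -/
theorem continuous_subst_left (γ : Matrix (Fin 2) (Fin 2) ℤ_[p]) :
    Continuous fun f : BinaryQuartic ℤ_[p] ↦ f.subst γ := by
  refine (continuous_iff _).mpr ⟨?_, ?_, ?_, ?_, ?_⟩ <;> simp only [subst] <;> fun_prop

/-- Scaling by a fixed scalar is continuous on `V_{ℤ_p}`. [folklore] -/
theorem continuous_smul_left (t : ℤ_[p]) : Continuous fun f : BinaryQuartic ℤ_[p] ↦ t • f := by
  refine (continuous_iff _).mpr ⟨?_, ?_, ?_, ?_, ?_⟩ <;>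
    simp only [smul_a, smul_b, smul_c, smul_d, smul_e] <;> fun_prop

/-- **The action of `g ∈ GL₂(ℤ_p)` on `V_{ℤ_p}` is continuous.** [folklore] -/
theorem continuous_glInt_smul (g : GL (Fin 2) ℤ_[p]) : Continuous fun f : BinaryQuartic ℤ_[p] ↦ g • f := by
  simp only [glInt_smul_def]
  exact (continuous_smul_left _).comp (continuous_subst_left _)

/-- The action of `g` is measurable. [folklore] -/
theorem measurable_glInt_smul (g : GL (Fin 2) ℤ_[p]) : Measurable fun f : BinaryQuartic ℤ_[p] ↦ g • f :=
  (continuous_glInt_smul g).measurable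

/-- The action of `g` transported to coefficient vectors: a continuous additive automorphism of
`ℤ_p⁵`. [folklore] -/
def coeffsSMulAddEquiv (g : GL (Fin 2) ℤ_[p]) : (Fin 5 → ℤ_[p]) ≃+ (Fin 5 → ℤ_[p]) :=
  ((coeffsLinearEquiv (R := ℤ_[p])).symm.toAddEquiv.trans (smulAddEquiv g)).trans
    (coeffsLinearEquiv (R := ℤ_[p])).toAddEquiv

/-- Its value: `v ↦ coeffs (g • form(v))`. [folklore] -/
theorem coeffsSMulAddEquiv_apply (g : GL (Fin 2) ℤ_[p]) (v : Fin 5 → ℤ_[p]) :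
    coeffsSMulAddEquiv g v = (g • (coeffsLinearEquiv (R := ℤ_[p])).symm v).coeffs := rfl

/-- It is continuous. [folklore] -/
theorem continuous_coeffsSMulAddEquiv (g : GL (Fin 2) ℤ_[p]) : Continuous (coeffsSMulAddEquiv g) := by
  have h : (coeffsSMulAddEquiv g : (Fin 5 → ℤ_[p]) → (Fin 5 → ℤ_[p])) =
      coeffs ∘ (fun f : BinaryQuartic ℤ_[p] ↦ g • f) ∘ ((coeffsLinearEquiv (R := ℤ_[p])).symm) := rfl
  rw [h]
  exact continuous_coeffs.comp ((continuous_glInt_smul g).comp continuous_coeffsLinearEquiv_symm)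

/-- The coefficient image of `g • S` is the image of `coeffs '' S` under the transported
automorphism. [folklore] -/
theorem image_coeffs_image_glInt_smul (g : GL (Fin 2) ℤ_[p]) (S : Set (BinaryQuartic ℤ_[p])) :
    coeffs '' ((fun f ↦ g • f) '' S) = coeffsSMulAddEquiv g '' (coeffs '' S) := by
  rw [Set.image_image, Set.image_image]
  refine Set.image_congr fun f _ ↦ ?_
  rw [coeffsSMulAddEquiv_apply]
  congr 2

/-- **Invariance of `μ_p`**: `μ_p(g • S) = μ_p(S)` for `g ∈ GL₂(ℤ_p)` and every `S ⊆ V_{ℤ_p}` (the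
action is a continuous additive automorphism of the compact group `V_{ℤ_p} ≅ ℤ_p⁵`).
[cite: BhargavaShankarAnnals2015, Prop. 5.12 proof (μ_p and PGL₂(ℤ_p)-orbits; arXiv:1006.1002v2 numbering)] -/
theorem padicInt_volume_image_glInt_smul (g : GL (Fin 2) ℤ_[p]) (S : Set (BinaryQuartic ℤ_[p])) :
    volume ((fun f ↦ g • f) '' S) = volume S := by
  rw [volume_eq_volume_image_coeffs, volume_eq_volume_image_coeffs S, image_coeffs_image_glInt_smul]
  exact Literature.MeasureTheory.Group.padicInt_pi_volume_image_addEquiv _ (continuous_coeffsSMulAddEquiv g) _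

/-- The preimage under `g •` is the image under `g⁻¹ •`. [folklore] -/
theorem preimage_glInt_smul (g : GL (Fin 2) ℤ_[p]) (S : Set (BinaryQuartic ℤ_[p])) :
    (fun f ↦ g • f) ⁻¹' S = (fun f ↦ g⁻¹ • f) '' S := by
  ext f
  simp only [Set.mem_preimage, Set.mem_image]
  constructor
  · intro hf; exact ⟨g • f, hf, by rw [← mul_smul, inv_mul_cancel, one_smul]⟩
  · rintro ⟨f', hf', rfl⟩; rwa [← mul_smul, mul_inv_cancel, one_smul]

/-- **The action of `g ∈ GL₂(ℤ_p)` preserves `μ_p`.** [cite: BhargavaShankarAnnals2015, Prop. 5.12 proof (arXiv:1006.1002v2 numbering)] -/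
theorem measurePreserving_glInt_smul (g : GL (Fin 2) ℤ_[p]) :
    MeasurePreserving (fun f : BinaryQuartic ℤ_[p] ↦ g • f) volume volume := by
  refine ⟨measurable_glInt_smul g, Measure.ext fun S hS ↦ ?_⟩
  rw [Measure.map_apply (measurable_glInt_smul g) hS, preimage_glInt_smul, padicInt_volume_image_glInt_smul]

/-! ## Orbits: `GL₂(ℤ_p) · f` in `V_{ℤ_p}` versus `ℚ_pˣ·GL₂(ℤ_p) · (f ⊗ ℚ_p)` in `V_{ℚ_p}` -/

/-- `GL₂(ℤ_p) → GL₂(ℚ_p)` lands in `ℚ_pˣ · GL₂(ℤ_p)`. [folklore] -/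
private theorem mapGL_mem_aux (k : GL (Fin 2) ℤ_[p]) :
    Matrix.GeneralLinearGroup.map PadicInt.Coe.ringHom k ∈ integralUpToScalars (PadicInt.Coe.ringHom (p := p)) :=
  mem_integralUpToScalars_of_eq_map _ (Matrix.isUnits_det_units k) rfl

/-- Every element of `ℚ_pˣ · GL₂(ℤ_p)` is a scalar times the image of an element of `GL₂(ℤ_p)`.
[folklore] -/
theorem exists_eq_scalar_mul_map {h : GL (Fin 2) ℚ_[p]} (hh : h ∈ integralUpToScalars (PadicInt.Coe.ringHom (p := p))) :
    ∃ (c : ℚ_[p]) (k : GL (Fin 2) ℤ_[p]), c ≠ 0 ∧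
      (h : Matrix (Fin 2) (Fin 2) ℚ_[p]) = c • ((Matrix.GeneralLinearGroup.map PadicInt.Coe.ringHom k : GL (Fin 2) ℚ_[p]) : Matrix (Fin 2) (Fin 2) ℚ_[p]) := by
  obtain ⟨c, k, hc, hk, hhk⟩ := hh
  obtain ⟨u, hu⟩ := hk
  refine ⟨c, ⟨k, (↑u⁻¹ : ℤ_[p]) • k.adjugate, ?_, ?_⟩, hc, hhk⟩
  · rw [Matrix.mul_smul, Matrix.mul_adjugate, ← hu, smul_smul, Units.inv_mul, one_smul]
  · rw [Matrix.smul_mul, Matrix.adjugate_mul, ← hu, smul_smul, Units.inv_mul, one_smul]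

/-- **The image in `V_{ℚ_p}` of the `GL₂(ℤ_p)`-orbit of `f ∈ V_{ℤ_p}` is the `ℚ_pˣ·GL₂(ℤ_p)`-orbit of
`f ⊗ ℚ_p`** (scalars act trivially). [cite: BhargavaShankarAnnals2015, §3.2 (PGL₂(ℤ_p)-orbits; published numbering)] -/
theorem image_orbit_eq_orbit_integralUpToScalars (f : BinaryQuartic ℤ_[p]) :
    BinaryQuartic.map PadicInt.Coe.ringHom '' (orbit (GL (Fin 2) ℤ_[p]) f) =
      orbit (integralUpToScalars (PadicInt.Coe.ringHom (p := p))) (f.map PadicInt.Coe.ringHom) := by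
  ext g
  simp only [Set.mem_image, mem_orbit_iff]
  constructor
  · rintro ⟨f', ⟨k, rfl⟩, rfl⟩
    refine ⟨⟨_, mapGL_mem_aux k⟩, ?_⟩
    rw [Subgroup.mk_smul]
    exact (map_glInt_smul' k f).symm
  · rintro ⟨⟨h, hh⟩, rfl⟩
    obtain ⟨c, k, hc, hck⟩ := exists_eq_scalar_mul_map hh
    refine ⟨k • f, ⟨k, rfl⟩, ?_⟩
    rw [map_glInt_smul, Subgroup.mk_smul, gl_smul_def, hck, twist_smul hc]
    rfl

end Padic

end BinaryQuartic

end Literature.NumberTheory.EllipticCurves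

end
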